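import Literature.AnabelianGeometry.AbsoluteAnabelian.LogFrobeniusArchGenuineMonoAn
import Literature.AnabelianGeometry.AbsoluteAnabelian.LogFrobeniusCor55ivGeometricArch
import Literature.AnabelianGeometry.AbsoluteAnabelian.LogFrobeniusLogWallArchOrigin
import Literature.AnabelianGeometry.AbsoluteAnabelian.LogFrobeniusLogWallNonarchModel
import Literature.AnabelianGeometry.AbsoluteAnabelian.LogFrobeniusLogWallNonarchOrigin
import Literature.AnabelianGeometry.AbsoluteAnabelian.LogFrobeniusMonoGenuineModel
import Literature.AnabelianGeometry.AbsoluteAnabelian.LogFrobeniusMonoGenuineProp58viiPf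
import Literature.AnabelianGeometry.AbsoluteAnabelian.LogFrobeniusNonarchGenuineOver
import Literature.AnabelianGeometry.AbsoluteAnabelian.LogFrobeniusNotSimCompatArchAllTS

/-!
# Kernel DAG index — layer X = MIXED delta (L4 ×2; one file per cycle under the live-queue discipline), part q (GENERATED by abc-iut-c312-2 gen 7 `work/gen_index.py` @2026-08-27T01:18Z from HOME/plan/DAG.tsv +
KERNEL-DAG-MODULES.tsv (regenerated 2026-08-27T01:04:09Z): 2 landed/discharged nodes NOT YET in the tree index Summits/ABC/IUTFork/DAG*.lean; spec v1.3 §2 (M))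

THIS FILE PROVES NOTHING NEW AND ASSERTS NOTHING (HOME/plan/KERNEL-DAG-SPEC.md). It gives ONE NAME `N_<kernel_id>` to each DAG node whose
statement has LANDED through the gate, knitting the landed declarations BY NAME: claim nodes `N_<id> : Prop := StatementOf @thm₁ ∧ …` (one
conjunct per landed theorem the DAG row names, universe levels instantiated explicitly per the spec's UNIVERSE RULE, arities read off the farm),
witnessed `N_<id>_holds` iff the DAG row is `discharged(p…)` and `N_<id>_part` otherwise (spec §2(b),(c); c312-2 F1/F2); data nodes
`abbrev N_<id> := @<primary>` with the row's further declarations as `example := @…` lines; FACT-style `def … : Prop` declarations are data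
here (a NAME, never asserted). Decl lists come from the `decls` column of plan/DAG.tsv as resolved against the tree sources (unresolvable
tokens dropped and reported to abc-iut-dag on STATUS). Nothing here says abc is proved or refuted or takes a side on [IUTchIII] Cor 3.12.
typed ≠ discharged; indexed ≠ endorsed.
-/

namespace Summit.ABC.IUTFork.DAG

namespace PartXq
/-- `StatementOf h` is the statement (a `Prop`) of which the landed `h` is the proof: the index NAMES statements, it never re-types them. -/
abbrev StatementOf {P : Prop} (_h : P) : Prop := P
end PartXq
open PartXq

noncomputable section
universe u₁ u₂ u₃ u₄ u₅ u₆ u₇ u₈ u₉ u₁₀ u₁₁ u₁₂ u₁₃ u₁₄ u₁₅ u₁₆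


/-- [node AbsTopIII:Cor5.5(iv) · L4/D1 · [AbsTopIII] Cor 5.5 (iv), kurims p.129 · p408757 · claim · DAG status landed(p408757)] decls 11 · CORRECTED SIBLING of the mis-resolved landed alias `N_AbsTopIII_Cor5_5_iv` (append-only re-key; dag: kernel_id := `N_AbsTopIII_Cor5_5_iv'`) · decl list as NAMED BY THE AUDITOR/LEAD (forced, not re-resolved) · cites→ AbsTopIII:Cor5.2,AbsTopIII:Def3.5,AbsTopIII:Def5.1,AbsTopIII:Def5.4,AbsTopIII:Rmk5.2.2 -/
def N_AbsTopIII_Cor5_5_iv' : Prop :=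
  StatementOf @Literature.AnabelianGeometry.AbsoluteAnabelian.LogFrobeniusSetting.archGenuine_cor55iv.{u₁} ∧
  StatementOf @Literature.AnabelianGeometry.AbsoluteAnabelian.LogFrobeniusSetting.archGenuine_complexPlane_cor55iv_all ∧
  StatementOf @Literature.AnabelianGeometry.AbsoluteAnabelian.LogFrobeniusSetting.archGenuine_cor55NotSimultaneouslyCompatible.{u₁} ∧
  StatementOf @Literature.AnabelianGeometry.AbsoluteAnabelian.LogFrobeniusSetting.archGenuine_cor55LogWall.{u₁} ∧
  StatementOf @Literature.AnabelianGeometry.AbsoluteAnabelian.LogFrobeniusSetting.archGenuine_cor55Incompatibility.{u₁} ∧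
  StatementOf @Literature.AnabelianGeometry.AbsoluteAnabelian.LogFrobeniusSetting.nonarchGenuine_cor55LogWall_and_notSimCompat ∧
  StatementOf @Literature.AnabelianGeometry.AbsoluteAnabelian.LogFrobeniusSetting.nonarchGenuineMono_cor55LogWall_and_notSimCompat ∧
  StatementOf @Literature.AnabelianGeometry.AbsoluteAnabelian.LogFrobeniusSetting.nonarchGenuineOver_cor55LogWall_and_notSimCompat ∧
  StatementOf @Literature.AnabelianGeometry.AbsoluteAnabelian.LogFrobeniusSetting.nonarchGenuineSlim_cor55LogWall_and_notSimCompat ∧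
  StatementOf @Literature.AnabelianGeometry.AbsoluteAnabelian.LogFrobeniusSetting.cor55iv_of_iota_spaceLink_not_surjective.{u₁, u₂} ∧
  StatementOf @Literature.AnabelianGeometry.AbsoluteAnabelian.LogFrobeniusSetting.cor55LogWall_and_notSimCompat_of_iota_injective.{u₁, u₂}
/-- partial witness (DAG row not marked discharged) of `N_AbsTopIII_Cor5_5_iv'`: the landed theorems it names, BY NAME (spec §2(c)); proves nothing new. -/
theorem N_AbsTopIII_Cor5_5_iv'_part : N_AbsTopIII_Cor5_5_iv' := ⟨@Literature.AnabelianGeometry.AbsoluteAnabelian.LogFrobeniusSetting.archGenuine_cor55iv, @Literature.AnabelianGeometry.AbsoluteAnabelian.LogFrobeniusSetting.archGenuine_complexPlane_cor55iv_all, @Literature.AnabelianGeometry.AbsoluteAnabelian.LogFrobeniusSetting.archGenuine_cor55NotSimultaneouslyCompatible, @Literature.AnabelianGeometry.AbsoluteAnabelian.LogFrobeniusSetting.archGenuine_cor55LogWall, @Literature.AnabelianGeometry.AbsoluteAnabelian.LogFrobeniusSetting.archGenuine_cor55Incompatibility, @Literature.AnabelianGeometry.AbsoluteAnabelian.LogFrobeniusSetting.nonarchGenuine_cor55LogWall_and_notSimCompat,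 @Literature.AnabelianGeometry.AbsoluteAnabelian.LogFrobeniusSetting.nonarchGenuineMono_cor55LogWall_and_notSimCompat, @Literature.AnabelianGeometry.AbsoluteAnabelian.LogFrobeniusSetting.nonarchGenuineOver_cor55LogWall_and_notSimCompat, @Literature.AnabelianGeometry.AbsoluteAnabelian.LogFrobeniusSetting.nonarchGenuineSlim_cor55LogWall_and_notSimCompat, @Literature.AnabelianGeometry.AbsoluteAnabelian.LogFrobeniusSetting.cor55iv_of_iota_spaceLink_not_surjective, @Literature.AnabelianGeometry.AbsoluteAnabelian.LogFrobeniusSetting.cor55LogWall_and_notSimCompat_of_iota_injective⟩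

/-- [node AbsTopIII:Prop5.8(vii) · L4/D1 · [AbsTopIII] Prop 5.8 (vii), kurims p.139 · p467152 · claim · DAG status discharged(p467152)] decls 14 · CORRECTED SIBLING of the mis-resolved landed alias `N_AbsTopIII_Prop5_8_vii` (append-only re-key; dag: kernel_id := `N_AbsTopIII_Prop5_8_vii'`) · decl list as NAMED BY THE AUDITOR/LEAD (forced, not re-resolved) · cites→ AbsTopIII:Def4.1,AbsTopIII:Def5.1,AbsTopIII:Def5.4,AbsTopIII:Def5.6,AbsTopIII:Prop5.7 -/
def N_AbsTopIII_Prop5_8_vii' : Prop :=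
  StatementOf @Literature.AnabelianGeometry.AbsoluteAnabelian.LogFrobeniusSetting.exists_genuine_prop58vii_pf ∧
  StatementOf @Literature.AnabelianGeometry.AbsoluteAnabelian.LogFrobeniusSetting.nonarchGenuineMonoAnPf_cor510MonoCores ∧
  StatementOf @Literature.AnabelianGeometry.AbsoluteAnabelian.LogFrobeniusSetting.nonarchGenuineMonoAnPf_ψOver ∧
  StatementOf @Literature.AnabelianGeometry.AbsoluteAnabelian.LogFrobeniusSetting.nonarchGenuineMonoAnPf_ψAnMono ∧
  StatementOf @Literature.AnabelianGeometry.AbsoluteAnabelian.LogFrobeniusSetting.exists_archGenuineMonoAn.{u₁} ∧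
  StatementOf @Literature.AnabelianGeometry.AbsoluteAnabelian.LogFrobeniusSetting.archGenuineMonoAn_ψOver.{u₁} ∧
  StatementOf @Literature.AnabelianGeometry.AbsoluteAnabelian.LogFrobeniusSetting.archGenuineMonoAn_cor510MonoCores.{u₁} ∧
  StatementOf @Literature.AnabelianGeometry.AbsoluteAnabelian.TMMono.anArcEquiv_inverse.{u₁}
/-- discharge of `N_AbsTopIII_Prop5_8_vii'`: the landed theorems it names, BY NAME (spec §2(c)); proves nothing new. -/
theorem N_AbsTopIII_Prop5_8_vii'_holds : N_AbsTopIII_Prop5_8_vii' := ⟨@Literature.AnabelianGeometry.AbsoluteAnabelian.LogFrobeniusSetting.exists_genuine_prop58vii_pf, @Literature.AnabelianGeometry.AbsoluteAnabelian.LogFrobeniusSetting.nonarchGenuineMonoAnPf_cor510MonoCores, @Literature.AnabelianGeometry.AbsoluteAnabelian.LogFrobeniusSetting.nonarchGenuineMonoAnPf_ψOver, @Literature.AnabelianGeometry.AbsoluteAnabelian.LogFrobeniusSetting.nonarchGenuineMonoAnPf_ψAnMono, @Literature.AnabelianGeometry.AbsoluteAnabelian.LogFrobeniusSetting.exists_archGenuineMonoAn,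 @Literature.AnabelianGeometry.AbsoluteAnabelian.LogFrobeniusSetting.archGenuineMonoAn_ψOver, @Literature.AnabelianGeometry.AbsoluteAnabelian.LogFrobeniusSetting.archGenuineMonoAn_cor510MonoCores, @Literature.AnabelianGeometry.AbsoluteAnabelian.TMMono.anArcEquiv_inverse⟩
example := @Literature.AnabelianGeometry.AbsoluteAnabelian.LogFrobeniusSetting.nonarchGenuineMonoAnPf
example := @Literature.AnabelianGeometry.AbsoluteAnabelian.LogFrobeniusSetting.nonarchGenuineMonoAnPf_iotaAnMono
example := @Literature.AnabelianGeometry.AbsoluteAnabelian.LogFrobeniusSetting.archGenuineMonoAn.{u₁}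
example := @Literature.AnabelianGeometry.AbsoluteAnabelian.TMMono.anArcEquiv.{u₁}
example := @Literature.AnabelianGeometry.AbsoluteAnabelian.MLFClosure.ψMonoPf
example := @Literature.AnabelianGeometry.AbsoluteAnabelian.MLFClosure.ιMonoPf

end

end Summit.ABC.IUTFork.DAG
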